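/-
Copyright (c) 2026 the pub-hodgecm-mathlib formalisation cell (harness21).  Prover seat hodgecm-mathlib-K2E3-p25 (g2), HCML Track B «K2-LIT»,
h413 = `stmt-HodgeConjecture-24833`, road (11-3-split-nsc), leaf (nsc-S-A′), brick (E4b-1γ, part 1 = SUPPORT) of the weak cell lemma (dealer D105 re-pointed;
architecture K2E3-p14 (g7) «NCQ dévissage», K2 bus 2026-09-04 12:00Z; consumer letter L2 of K2E3-p03 12:12Z).  2026-09-04.
-/
import Literature.NumberTheory.Automorphic.InducedWhittakerVanishing     -- ★ `vanishingOn`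
import Literature.NumberTheory.Automorphic.WhittakerSupportFinite        -- ★ `transvectionUnit`
import Literature.NumberTheory.Automorphic.ParabolicGL                   -- ★ `standardParabolicGL`
import HarnessLib

/-!
# K2_E3 road (h413), leaf (nsc-S-A′), brick E4b-1γ part 1 — the OPEN `(B, P_{(2,1)})`-cell of `GL₃`: cell functions vanish far out (the support lemma)

Cell `pub/hodgecm-mathlib` (D-0151), Track B, seat K2E3-p25 (g2) (leaf owner ∕ architect).  `--supports stmt-HodgeConjecture-24833 --as helper`; THEOREMS ONLY
(no `def`, no instance, no notation, no `sorry`); never imports `Cruxes/…/Lines`.  COUNT-NEUTRAL.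

THE MATHEMATICS ([BernsteinZelevinsky1977, §5, proof of Thm. 5.2 (the open orbit)]; [Casselman1995, Prop. 6.3.1]).  `G = GL₃(F)`, `B` the upper Borel,
`P = P_{(2,1)}`, `Z = {g ∣ m(g) = 0}` with the minor `m(g) = g₁₀g₂₁ − g₁₁g₂₀` (★ E4b-1α: `Z = C₀ ∪ C₁` is closed, right `P`-stable; its complement is the open cell
`B·w·P`).  For a smooth `f ∈ Ind_B^G σ′` VANISHING ON `Z` the cell functions `u ↦ f(w·u·m)` on `U_P ≅ F²` are COMPACTLY SUPPORTED.  The proof is algebraic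
(K2E3-p14's device): right multiplication by the lower root elements `t₂₀(α) = 1 + αE₂₀`, `t₂₁(β) = 1 + βE₂₁` moves the minor LINEARLY,
  `m(h·t₂₀(α)) = m(h) + α·(h₁₂h₂₁ − h₁₁h₂₂)`,   `m(h·t₂₁(β)) = m(h) + β·(h₁₀h₂₂ − h₁₂h₂₀)`   (§1),
and the coefficients `p, q` satisfy `h₁₀p + h₁₁q = h₁₂·m(h)`, `h₂₀p + h₂₁q = h₂₂·m(h)`; so once `|h₁₂|` or `|h₂₂|` is large against the `{1,2}×{0,1}` block of `h`, some
`α` (or `β`) of valuation `< ε` kills the minor: `h·t ∈ Z`.  If `t` fixes `f` (smoothness: all `t₂₀(α), t₂₁(β)` with `|α|,|β| < ε` do, §2 `exists_transvections_fix`)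
then `f(h) = f(h·t) = 0` (§2 **`toFun_eq_zero_of_entry_large`**).  For `h = w·n(x,y)·diag(ω,1)` (`w = (e₀↦e₁↦e₂↦e₀)`) one has `h₁₂ = x`, `h₂₂ = y`, block `= ω`,
`m(h) = det ω`: the cell function vanishes for `max(|x|,|y|) ≥ ‖ω‖∕ε` — uniformly for `ω ∈ GL₂(𝒪)` (parts 2–3: the cell map and its kernel).

HONEST LABEL: HC_CM is proved only modulo the 7 printed citations (2 remaining named inputs: hLiu418 = stmt-HodgeConjecture-24832, h413 = stmt-HodgeConjecture-24833) until rung 0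
closes; count-neutral helper.

## References
* [BernsteinZelevinsky1977] I. N. Bernstein, A. V. Zelevinsky, *Induced representations of reductive p-adic groups I*, Ann. Sci. ÉNS 10 (1977), §5 (Thm. 5.2).
* [Casselman1995] W. Casselman, *Introduction to the theory of admissible representations of p-adic reductive groups* (draft 1995), Prop. 6.3.1, §6.3.
-/

set_option autoImplicit false
set_option linter.dupNamespace false

noncomputable section

open Function Representation ValuativeRel
open scoped MatrixGroups
open Literature.NumberTheory.Automorphic

namespace Summit.HodgeConjecture.HodgeConjecture.Cruxes.H413.K2E3GL3BorelInducedJacquetQOpenCellSupport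

variable {F : Type} [Field F] [ValuativeRel F] [TopologicalSpace F] [IsNonarchimedeanLocalField F]

/-! ## §1 The minor under right multiplication by the lower root elements `t₂₀(α)`, `t₂₁(β)` -/

omit [ValuativeRel F] [TopologicalSpace F] [IsNonarchimedeanLocalField F] in
/-- Entries of `g · t₂₀(α)`: column `0` becomes `col₀ + α·col₂`, the other columns are unchanged. [folklore] -/
theorem mul_transvectionUnit_two_zero_apply (g : GL (Fin 3) F) (α : F) (i j : Fin 3) :
    ((g * transvectionUnit 2 0 (by decide) α : GL (Fin 3) F) : Matrix (Fin 3) (Fin 3) F) i j =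
      (g : Matrix (Fin 3) (Fin 3) F) i j + (if j = 0 then α * (g : Matrix (Fin 3) (Fin 3) F) i 2 else 0) := by
  rw [Units.val_mul, coe_transvectionUnit, Matrix.mul_add, Matrix.mul_one, Matrix.add_apply]
  congr 1
  rw [Matrix.mul_apply, Fin.sum_univ_three]
  fin_cases j <;> simp [mul_comm]

omit [ValuativeRel F] [TopologicalSpace F] [IsNonarchimedeanLocalField F] in
/-- Entries of `g · t₂₁(β)`: column `1` becomes `col₁ + β·col₂`, the other columns are unchanged. [folklore] -/
theorem mul_transvectionUnit_two_one_apply (g : GL (Fin 3) F) (β : F) (i j : Fin 3) :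
    ((g * transvectionUnit 2 1 (by decide) β : GL (Fin 3) F) : Matrix (Fin 3) (Fin 3) F) i j =
      (g : Matrix (Fin 3) (Fin 3) F) i j + (if j = 1 then β * (g : Matrix (Fin 3) (Fin 3) F) i 2 else 0) := by
  rw [Units.val_mul, coe_transvectionUnit, Matrix.mul_add, Matrix.mul_one, Matrix.add_apply]
  congr 1
  rw [Matrix.mul_apply, Fin.sum_univ_three]
  fin_cases j <;> simp [mul_comm]

omit [ValuativeRel F] [TopologicalSpace F] [IsNonarchimedeanLocalField F] in
/-- **`m(g·t₂₀(α)) = m(g) + α·(g₁₂g₂₁ − g₁₁g₂₂)`** for the minor `m(g) = g₁₀g₂₁ − g₁₁g₂₀`. [cite: BernsteinZelevinsky1977, §5] -/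
theorem minor_mul_transvectionUnit_two_zero (g : GL (Fin 3) F) (α : F) :
    ((g * transvectionUnit 2 0 (by decide) α : GL (Fin 3) F) : Matrix (Fin 3) (Fin 3) F) 1 0 *
        ((g * transvectionUnit 2 0 (by decide) α : GL (Fin 3) F) : Matrix (Fin 3) (Fin 3) F) 2 1 -
      ((g * transvectionUnit 2 0 (by decide) α : GL (Fin 3) F) : Matrix (Fin 3) (Fin 3) F) 1 1 *
        ((g * transvectionUnit 2 0 (by decide) α : GL (Fin 3) F) : Matrix (Fin 3) (Fin 3) F) 2 0 =
      ((g : Matrix (Fin 3) (Fin 3) F) 1 0 * (g : Matrix (Fin 3) (Fin 3) F) 2 1 - (g : Matrix (Fin 3) (Fin 3) F) 1 1 * (g : Matrix (Fin 3) (Fin 3) F) 2 0) +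
        α * ((g : Matrix (Fin 3) (Fin 3) F) 1 2 * (g : Matrix (Fin 3) (Fin 3) F) 2 1 - (g : Matrix (Fin 3) (Fin 3) F) 1 1 * (g : Matrix (Fin 3) (Fin 3) F) 2 2) := by
  simp only [mul_transvectionUnit_two_zero_apply]
  simp only [if_true, show (1 : Fin 3) ≠ 0 by decide, if_false, add_zero]
  ring

omit [ValuativeRel F] [TopologicalSpace F] [IsNonarchimedeanLocalField F] in
/-- **`m(g·t₂₁(β)) = m(g) + β·(g₁₀g₂₂ − g₁₂g₂₀)`**. [cite: BernsteinZelevinsky1977, §5] -/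
theorem minor_mul_transvectionUnit_two_one (g : GL (Fin 3) F) (β : F) :
    ((g * transvectionUnit 2 1 (by decide) β : GL (Fin 3) F) : Matrix (Fin 3) (Fin 3) F) 1 0 *
        ((g * transvectionUnit 2 1 (by decide) β : GL (Fin 3) F) : Matrix (Fin 3) (Fin 3) F) 2 1 -
      ((g * transvectionUnit 2 1 (by decide) β : GL (Fin 3) F) : Matrix (Fin 3) (Fin 3) F) 1 1 *
        ((g * transvectionUnit 2 1 (by decide) β : GL (Fin 3) F) : Matrix (Fin 3) (Fin 3) F) 2 0 =
      ((g : Matrix (Fin 3) (Fin 3) F) 1 0 * (g : Matrix (Fin 3) (Fin 3) F) 2 1 - (g : Matrix (Fin 3) (Fin 3) F) 1 1 * (g : Matrix (Fin 3) (Fin 3) F) 2 0) +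
        β * ((g : Matrix (Fin 3) (Fin 3) F) 1 0 * (g : Matrix (Fin 3) (Fin 3) F) 2 2 - (g : Matrix (Fin 3) (Fin 3) F) 1 2 * (g : Matrix (Fin 3) (Fin 3) F) 2 0) := by
  simp only [mul_transvectionUnit_two_one_apply]
  simp only [if_true, show (0 : Fin 3) ≠ 1 by decide, if_false, add_zero]
  ring

/-! ## §2 Cell functions vanishing on `Z` vanish far out -/

variable (σ' : Representation ℂ ↥(standardParabolicGL F (id : Fin 3 → Fin 3)) ℂ)

/-- **Smoothness gives an `ε`**: for `f ∈ Ind_B^G σ′` there is a unit `ε` of the value group such that all lower root elements `t₂₀(α)`, `t₂₁(β)` with `|α|, |β| < ε` fix `f`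
under right translation (the stabiliser of `f` is open, `α ↦ t₂₀(α)` is continuous, neighbourhoods of `0` contain valuation balls). [cite: BernsteinZelevinsky1977, §2.1] -/
theorem exists_transvections_fix (f : SmoothInd (standardParabolicGL F (id : Fin 3 → Fin 3)) σ') :
    ∃ ε : (ValueGroupWithZero F)ˣ,
      (∀ α : F, valuation F α < ε → smoothIndRep (standardParabolicGL F (id : Fin 3 → Fin 3)) σ' (transvectionUnit 2 0 (by decide) α) f = f) ∧
      (∀ β : F, valuation F β < ε → smoothIndRep (standardParabolicGL F (id : Fin 3 → Fin 3)) σ' (transvectionUnit 2 1 (by decide) β) f = f) := by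
  haveI : IsTopologicalRing F := inferInstance
  have hopen : IsOpen (((smoothIndRep (standardParabolicGL F (id : Fin 3 → Fin 3)) σ').stabilizerSubgroup f : Subgroup (GL (Fin 3) F)) :
      Set (GL (Fin 3) F)) := isSmooth_smoothInd _ _ f
  -- continuity of `α ↦ t_{ij}(α)`
  have hcont : ∀ (i j : Fin 3) (hij : i ≠ j), Continuous fun α : F => (transvectionUnit i j hij α : GL (Fin 3) F) := by
    intro i j hij
    have hsingle : ∀ s : F → F, Continuous s → Continuous fun α : F => (1 : Matrix (Fin 3) (Fin 3) F) + Matrix.single i j (s α) := by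
      intro s hs
      refine continuous_const.add (continuous_matrix fun i' j' => ?_)
      simp only [Matrix.single_apply]
      split_ifs
      · exact hs
      · exact continuous_const
    refine Units.continuous_iff.2 ⟨?_, ?_⟩
    · change Continuous fun α : F => (1 : Matrix (Fin 3) (Fin 3) F) + Matrix.single i j α
      exact hsingle id continuous_id
    · change Continuous fun α : F => (((transvectionUnit i j hij α)⁻¹ : GL (Fin 3) F) : Matrix (Fin 3) (Fin 3) F)
      simp_rw [transvectionUnit_inv, coe_transvectionUnit]
      exact hsingle (fun α => -α) continuous_neg
  have hnhds : ∀ (i j : Fin 3) (hij : i ≠ j), ∃ γ : (ValueGroupWithZero F)ˣ, ∀ α : F, valuation F α < γ →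
      smoothIndRep (standardParabolicGL F (id : Fin 3 → Fin 3)) σ' (transvectionUnit i j hij α) f = f := by
    intro i j hij
    have h0 : (fun α : F => (transvectionUnit i j hij α : GL (Fin 3) F)) ⁻¹'
        (((smoothIndRep (standardParabolicGL F (id : Fin 3 → Fin 3)) σ').stabilizerSubgroup f : Subgroup (GL (Fin 3) F)) : Set (GL (Fin 3) F)) ∈ nhds (0 : F) := by
      refine (hopen.preimage (hcont i j hij)).mem_nhds ?_
      rw [Set.mem_preimage, transvectionUnit_zero, SetLike.mem_coe]
      exact Subgroup.one_mem _
    obtain ⟨γ, hγ⟩ := (IsValuativeTopology.mem_nhds_zero_iff _).1 h0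
    exact ⟨γ, fun α hα => (Representation.mem_stabilizerSubgroup _ _ _).1 (hγ hα)⟩
  obtain ⟨γ₁, h₁⟩ := hnhds 2 0 (by decide)
  obtain ⟨γ₂, h₂⟩ := hnhds 2 1 (by decide)
  refine ⟨min γ₁ γ₂, fun α hα => h₁ α (lt_of_lt_of_le hα ?_), fun β hβ => h₂ β (lt_of_lt_of_le hβ ?_)⟩
  · exact_mod_cast min_le_left γ₁ γ₂
  · exact_mod_cast min_le_right γ₁ γ₂

/-- A function vanishing on `Z` and fixed by `t` vanishes at every `h` with `h·t ∈ Z`: `f(h) = (t·f)(h) = f(h t) = 0`. [cite: BernsteinZelevinsky1977, §5] -/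
theorem toFun_eq_zero_of_mul_mem {Z : Set (GL (Fin 3) F)} {f : SmoothInd (standardParabolicGL F (id : Fin 3 → Fin 3)) σ'}
    (hf : f ∈ vanishingOn (standardParabolicGL F (id : Fin 3 → Fin 3)) σ' Z) {t : GL (Fin 3) F}
    (ht : smoothIndRep (standardParabolicGL F (id : Fin 3 → Fin 3)) σ' t f = f) {h : GL (Fin 3) F} (hZ : h * t ∈ Z) : f.toFun h = 0 := by
  have := congrArg (fun φ : SmoothInd (standardParabolicGL F (id : Fin 3 → Fin 3)) σ' => φ.toFun h) ht
  simp only [toFun_smoothIndRep_apply] at this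
  rw [← this]
  exact hf _ hZ

/-- **THE SUPPORT LEMMA OF THE OPEN CELL.**  `f ∈ Ind_B^G σ′` vanishing on `Z = {m = 0}` and fixed by all `t₂₀(α)`, `t₂₁(β)` with `|α|, |β| < ε`; `h ∈ GL₃(F)` with `m(h) ≠ 0`
and `M = max` of the valuations of the block `{1,2} × {0,1}` of `h`.  If `M < ε·|h₁₂|` or `M < ε·|h₂₂|`, then `f(h) = 0`.  (For `h = w·n(x,y)·diag(ω,1)`: block `= ω`,
`h₁₂ = x`, `h₂₂ = y`, `m(h) = det ω` — the cell function `(x,y) ↦ f(h)` is supported in the ball `max(|x|,|y|) ≤ ‖ω‖∕ε`.) [cite: BernsteinZelevinsky1977, §5 (Thm. 5.2)]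
[cite: Casselman1995, Prop. 6.3.1] -/
theorem toFun_eq_zero_of_entry_large {f : SmoothInd (standardParabolicGL F (id : Fin 3 → Fin 3)) σ'}
    (hf : f ∈ vanishingOn (standardParabolicGL F (id : Fin 3 → Fin 3)) σ'
      {g : GL (Fin 3) F | (g : Matrix (Fin 3) (Fin 3) F) 1 0 * (g : Matrix (Fin 3) (Fin 3) F) 2 1 - (g : Matrix (Fin 3) (Fin 3) F) 1 1 * (g : Matrix (Fin 3) (Fin 3) F) 2 0 = 0})
    {ε : (ValueGroupWithZero F)ˣ}
    (hα : ∀ α : F, valuation F α < ε → smoothIndRep (standardParabolicGL F (id : Fin 3 → Fin 3)) σ' (transvectionUnit 2 0 (by decide) α) f = f)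
    (hβ : ∀ β : F, valuation F β < ε → smoothIndRep (standardParabolicGL F (id : Fin 3 → Fin 3)) σ' (transvectionUnit 2 1 (by decide) β) f = f)
    (h : GL (Fin 3) F)
    (hm : (h : Matrix (Fin 3) (Fin 3) F) 1 0 * (h : Matrix (Fin 3) (Fin 3) F) 2 1 - (h : Matrix (Fin 3) (Fin 3) F) 1 1 * (h : Matrix (Fin 3) (Fin 3) F) 2 0 ≠ 0)
    (hlarge : max (max (valuation F ((h : Matrix (Fin 3) (Fin 3) F) 1 0)) (valuation F ((h : Matrix (Fin 3) (Fin 3) F) 1 1)))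
        (max (valuation F ((h : Matrix (Fin 3) (Fin 3) F) 2 0)) (valuation F ((h : Matrix (Fin 3) (Fin 3) F) 2 1))) <
      (ε : ValueGroupWithZero F) * max (valuation F ((h : Matrix (Fin 3) (Fin 3) F) 1 2)) (valuation F ((h : Matrix (Fin 3) (Fin 3) F) 2 2))) :
    f.toFun h = 0 := by
  -- names for the entries, the minor and the two coefficients
  set a := (h : Matrix (Fin 3) (Fin 3) F) 1 0 with ha
  set b := (h : Matrix (Fin 3) (Fin 3) F) 1 1 with hb
  set x := (h : Matrix (Fin 3) (Fin 3) F) 1 2 with hx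
  set c := (h : Matrix (Fin 3) (Fin 3) F) 2 0 with hc
  set d := (h : Matrix (Fin 3) (Fin 3) F) 2 1 with hd
  set y := (h : Matrix (Fin 3) (Fin 3) F) 2 2 with hy
  set m := a * d - b * c with hmdef
  set p := x * d - b * y with hp
  set q := a * y - x * c with hq
  set M := max (max (valuation F a) (valuation F b)) (max (valuation F c) (valuation F d)) with hM
  -- the two linear identities `a p + b q = x m`, `c p + d q = y m`
  have hid₁ : a * p + b * q = x * m := by rw [hp, hq, hmdef]; ring
  have hid₂ : c * p + d * q = y * m := by rw [hp, hq, hmdef]; ring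
  -- valuation consequences: `|x|·|m| ≤ M·max(|p|,|q|)`, `|y|·|m| ≤ M·max(|p|,|q|)`
  have hva : valuation F a ≤ M := (le_max_left _ _).trans (le_max_left _ _)
  have hvb : valuation F b ≤ M := (le_max_right _ _).trans (le_max_left _ _)
  have hvc : valuation F c ≤ M := (le_max_left _ _).trans (le_max_right _ _)
  have hvd : valuation F d ≤ M := (le_max_right _ _).trans (le_max_right _ _)
  have key : ∀ {u v z : F}, valuation F u ≤ M → valuation F v ≤ M → u * p + v * q = z * m →
      valuation F z * valuation F m ≤ M * max (valuation F p) (valuation F q) := by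
    intro u v z hu hv huv
    rw [← map_mul, ← huv]
    refine (Valuation.map_add _ _ _).trans (max_le ?_ ?_)
    · rw [map_mul]; exact mul_le_mul' hu (le_max_left _ _)
    · rw [map_mul]; exact mul_le_mul' hv (le_max_right _ _)
  have hxm := key hva hvb hid₁
  have hym := key hvc hvd hid₂
  have hvm : valuation F m ≠ 0 := (Valuation.ne_zero_iff _).2 hm
  have hε0 : ((ε : ValueGroupWithZero F)) ≠ 0 := ε.ne_zero
  -- from `M < ε·max(|x|,|y|)`: `|m| < ε·max(|p|,|q|)`
  have hmain : valuation F m < (ε : ValueGroupWithZero F) * max (valuation F p) (valuation F q) := by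
    have hxy : max (valuation F x) (valuation F y) * valuation F m ≤ M * max (valuation F p) (valuation F q) := by
      rcases le_total (valuation F x) (valuation F y) with hle | hle
      · rw [max_eq_right hle]; exact hym
      · rw [max_eq_left hle]; exact hxm
    by_contra hcon
    rw [not_lt] at hcon
    -- `M·max(p,q) ≥ max(x,y)·m ≥ max(x,y)·?`; combine with `hlarge`
    have h1 : M * max (valuation F p) (valuation F q) < (ε : ValueGroupWithZero F) * max (valuation F x) (valuation F y) * max (valuation F p) (valuation F q) ∨
        max (valuation F p) (valuation F q) = 0 := by
      by_cases h0 : max (valuation F p) (valuation F q) = 0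
      · exact Or.inr h0
      · exact Or.inl (mul_lt_mul_of_pos_right hlarge (lt_of_le_of_ne zero_le (Ne.symm h0)))
    rcases h1 with h1 | h0
    · have h2 : max (valuation F x) (valuation F y) * valuation F m <
          (ε : ValueGroupWithZero F) * max (valuation F x) (valuation F y) * max (valuation F p) (valuation F q) := lt_of_le_of_lt hxy h1
      have h3 : (ε : ValueGroupWithZero F) * max (valuation F x) (valuation F y) * max (valuation F p) (valuation F q) ≤
          max (valuation F x) (valuation F y) * valuation F m := by
        rw [mul_comm (ε : ValueGroupWithZero F), mul_assoc]
        exact mul_le_mul' (le_refl _) hcon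
      exact absurd (lt_of_lt_of_le h2 h3) (lt_irrefl _)
    · -- `p = q = 0` forces `x m = 0`, `y m = 0`, so `x = y = 0`, contradicting `hlarge` (`M ≥ 0`)
      have hp0 : valuation F p = 0 := le_antisymm (h0 ▸ le_max_left _ _) zero_le
      have hq0 : valuation F q = 0 := le_antisymm (h0 ▸ le_max_right _ _) zero_le
      rw [Valuation.zero_iff] at hp0 hq0
      have hx0 : x = 0 := by
        have := hid₁; rw [hp0, hq0, mul_zero, mul_zero, add_zero] at this
        exact (mul_eq_zero.1 this.symm).resolve_right hm
      have hy0 : y = 0 := by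
        have := hid₂; rw [hp0, hq0, mul_zero, mul_zero, add_zero] at this
        exact (mul_eq_zero.1 this.symm).resolve_right hm
      rw [hx0, hy0, map_zero, max_self, mul_zero] at hlarge
      exact absurd hlarge (not_lt.2 zero_le)
  -- so `|m| < ε |p|` or `|m| < ε |q|`; kill the minor with `t₂₀(−m/p)` or `t₂₁(−m/q)`
  rcases le_total (valuation F q) (valuation F p) with hle | hle
  · rw [max_eq_left hle] at hmain
    have hp0 : p ≠ 0 := fun h0 => by rw [h0, map_zero, mul_zero] at hmain; exact absurd hmain (not_lt.2 zero_le)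
    have hvα : valuation F (-m / p) < ε := by
      rw [map_div₀, Valuation.map_neg]
      have hvp : valuation F p ≠ 0 := (Valuation.ne_zero_iff _).2 hp0
      exact (div_lt_iff₀ (lt_of_le_of_ne zero_le hvp.symm)).2 hmain
    have hZ : h * transvectionUnit 2 0 (by decide) (-m / p) ∈
        {g : GL (Fin 3) F | (g : Matrix (Fin 3) (Fin 3) F) 1 0 * (g : Matrix (Fin 3) (Fin 3) F) 2 1 - (g : Matrix (Fin 3) (Fin 3) F) 1 1 * (g : Matrix (Fin 3) (Fin 3) F) 2 0 = 0} := by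
      rw [Set.mem_setOf_eq, minor_mul_transvectionUnit_two_zero]
      change m + -m / p * p = 0
      rw [div_mul_cancel₀ _ hp0, add_neg_cancel]
    exact toFun_eq_zero_of_mul_mem σ' hf (hα _ hvα) hZ
  · rw [max_eq_right hle] at hmain
    have hq0 : q ≠ 0 := fun h0 => by rw [h0, map_zero, mul_zero] at hmain; exact absurd hmain (not_lt.2 zero_le)
    have hvβ : valuation F (-m / q) < ε := by
      rw [map_div₀, Valuation.map_neg]
      have hvq : valuation F q ≠ 0 := (Valuation.ne_zero_iff _).2 hq0
      exact (div_lt_iff₀ (lt_of_le_of_ne zero_le hvq.symm)).2 hmain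
    have hZ : h * transvectionUnit 2 1 (by decide) (-m / q) ∈
        {g : GL (Fin 3) F | (g : Matrix (Fin 3) (Fin 3) F) 1 0 * (g : Matrix (Fin 3) (Fin 3) F) 2 1 - (g : Matrix (Fin 3) (Fin 3) F) 1 1 * (g : Matrix (Fin 3) (Fin 3) F) 2 0 = 0} := by
      rw [Set.mem_setOf_eq, minor_mul_transvectionUnit_two_one]
      change m + -m / q * q = 0
      rw [div_mul_cancel₀ _ hq0, add_neg_cancel]
    exact toFun_eq_zero_of_mul_mem σ' hf (hβ _ hvβ) hZ

end Summit.HodgeConjecture.HodgeConjecture.Cruxes.H413.K2E3GL3BorelInducedJacquetQOpenCellSupport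

end
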